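import Literature.Geometry.Lorentzian.KerrCylinderParameterClosenessK
import HarnessLib

/-!
# First-order spin derivatives of the Kerr–Schild fields at `a = 0`

Support file (all results proved; no named facts) for the named fact `LiMei.interiorKerrGluing`
(`InteriorKerrGluing.lean`; J. Li, H. Mei, *A construction of collapsing spacetimes in vacuum*,
Comm. Math. Phys. 378 (2020) = arXiv:2005.01249, Prop. 4.1): the ingredients of the "direct
computation" behind Li–Mei (4.2) (`ḡ_{m,a} = ḡ_m + O(a)`, `k̄_{m,a} = k̄_m + O(a)` with explicit
first-order terms). At a point `x` of the ingoing Kerr–Schild chart with `r(0, x) = |x⃗| > 0`,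
as functions of the spin `a` at `a = 0`:

* `Kerr.hasDerivAt_radius_spin`, `Kerr.hasDerivAt_scalarH_spin` — `r` and `H` are even in `a`,
  so `∂_a r = ∂_a H = 0`;
* `Kerr.hasDerivAt_nullCovector_spin` — `∂_a ℓ = δℓ := (0, x₂, −x₁, 0)/r²`
  (`Kerr.spinNullCovector`), and `Kerr.hasDerivAt_nullVector_spin` — `∂_a ℓ♯ = δℓ♯`
  (`Kerr.spinNullVector`, the same components);
* `Kerr.hasDerivAt_bilin_spin` — **`∂_a g_{M,a}(x)|_{a=0} = 2H (ℓ ⊗ δℓ + δℓ ⊗ ℓ)`**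
  (`Kerr.spinMetric`), as a form-valued derivative;
* `Kerr.hasDerivAt_radiusGradVec_spin`, `Kerr.hasDerivAt_radiusSharp_spin` — `∇r` is even,
  `∂_a (g♯dr) = −2H δℓ♯`;
* `LiMei.hasDerivAt_kerrCylUnitNormal_spin` — **the unit normal of the cylinders**,
  `∂_a n|_{a=0} = −2 (2M/r − 1)^{-1/2}·… = −c₀ 2H δℓ♯` with `c₀ = (−g(g♯dr, g♯dr))^{-1/2}`
  (the normalisation is even in `a`), wherever `Δ₀(r) = r² − 2Mr < 0`.

## References

* J. Li, H. Mei, *A construction of collapsing spacetimes in vacuum*, Comm. Math. Phys. 378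
  (2020), arXiv:2005.01249, §4, (4.2) (key `LiMei2020`).
* R. P. Kerr, A. Schild (1965), §3; M. Visser, arXiv:0706.0622, (32)–(35) (key `KerrSchild1965`).
-/

noncomputable section

open Set Filter Function Metric
open scoped Topology RealInnerProductSpace

namespace Literature.Geometry.Lorentzian

attribute [local instance] instNormedAddCommGroupBilinE4 instNormedSpaceBilinE4

/-! ### Even functions have zero derivative at `0` -/

/-- A function which is differentiable at `0` and even near `0` has derivative `0` there.
[folklore] -/
theorem hasDerivAt_zero_of_even {F : Type*} [NormedAddCommGroup F] [NormedSpace ℝ F]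
    {f : ℝ → F} (hf : DifferentiableAt ℝ f 0) (heven : ∀ a, f (-a) = f a) :
    HasDerivAt f 0 0 := by
  have h := hf.hasDerivAt
  have h2 : HasDerivAt (fun a ↦ f (-a)) ((-1 : ℝ) • deriv f 0) 0 := by
    have hg : HasDerivAt f (deriv f 0) (-0 : ℝ) := by rw [neg_zero]; exact h
    exact hg.scomp 0 (hasDerivAt_neg 0)
  have e : (fun a ↦ f (-a)) = f := funext heven
  rw [e] at h2
  have h3 : deriv f 0 = (-1 : ℝ) • deriv f 0 := h.unique h2
  have h0 : deriv f 0 = 0 := by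
    rw [neg_one_smul] at h3
    exact eq_neg_iff_add_eq_zero.1 h3 |> fun h' ↦ by
      have : (2 : ℝ) • deriv f 0 = 0 := by rw [two_smul]; exact h'
      exact (smul_eq_zero.1 this).resolve_left two_ne_zero
  rw [← h0]
  exact h

namespace Kerr

/-! ### `r` and `H` are even in the spin -/

/-- `r(−a, x) = r(a, x)`. [folklore] -/
theorem radius_neg (a : ℝ) (x : E4) : radius (-a) x = radius a x := by
  unfold radius
  rw [neg_sq]

/-- `H(M, −a, x) = H(M, a, x)`. [folklore] -/
theorem scalarH_neg (M a : ℝ) (x : E4) : scalarH M (-a) x = scalarH M a x := by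
  unfold scalarH
  rw [radius_neg, neg_sq]

/-- **`∂_a r(a, x)|_{a=0} = 0`** (`r` is even in `a`; `r(0, x) > 0`). [folklore] -/
theorem hasDerivAt_radius_spin {x : E4} (hx : 0 < radius 0 x) :
    HasDerivAt (fun a : ℝ ↦ radius a x) 0 0 := by
  refine hasDerivAt_zero_of_even ?_ fun a ↦ radius_neg a x
  have hg := (contDiffAt_radius₂ (p := ((0 : ℝ), x)) hx (n := 1)).differentiableAt one_ne_zero
  have hf : DifferentiableAt ℝ (fun a : ℝ ↦ ((a, x) : ℝ × E4)) 0 :=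
    differentiableAt_id.prodMk (differentiableAt_const x)
  have h := hg.comp 0 hf
  exact h

/-- **`∂_a H(M, a, x)|_{a=0} = 0`** (`H` is even in `a`). [folklore] -/
theorem hasDerivAt_scalarH_spin (M : ℝ) {x : E4} (hx : 0 < radius 0 x) :
    HasDerivAt (fun a : ℝ ↦ scalarH M a x) 0 0 := by
  refine hasDerivAt_zero_of_even ?_ fun a ↦ scalarH_neg M a x
  have hg := (contDiffAt_scalarH₂ M (p := ((0 : ℝ), x)) hx (n := 1)).differentiableAt one_ne_zero
  have hf : DifferentiableAt ℝ (fun a : ℝ ↦ ((a, x) : ℝ × E4)) 0 :=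
    differentiableAt_id.prodMk (differentiableAt_const x)
  have h := hg.comp 0 hf
  exact h

/-- Near `a = 0` the radius stays positive. [folklore] -/
theorem eventually_radius_pos {x : E4} (hx : 0 < radius 0 x) : ∀ᶠ a : ℝ in 𝓝 0, 0 < radius a x := by
  have hc : ContinuousAt (fun a : ℝ ↦ radius a x) 0 := (hasDerivAt_radius_spin hx).continuousAt
  exact hc.eventually (lt_mem_nhds hx)

/-! ### The null covector and vector: `∂_a ℓ = δℓ` -/

/-- Components of the first-order spin term of the null covector:
`δℓ = (0, x₂/r², −x₁/r², 0)`, `r = r(0, x)`. [cite: KerrSchild1965, §3] -/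
def spinNullCovectorFun (x : E4) : Fin 4 → ℝ :=
  ![0, x 2 / radius 0 x ^ 2, -(x 1 / radius 0 x ^ 2), 0]

/-- The first-order spin term `δℓ = ∂_a ℓ|_{a=0}` of the Kerr–Schild null covector.
[cite: KerrSchild1965, §3] -/
def spinNullCovector (x : E4) : E4 →L[ℝ] ℝ := E4.covector (spinNullCovectorFun x)

/-- The first-order spin term `δℓ♯ = ∂_a ℓ♯|_{a=0}` of the null vector (same components, the
time component being `0`). [cite: KerrSchild1965, §3] -/
def spinNullVector (x : E4) : E4 := WithLp.toLp 2 (spinNullCovectorFun x)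

/-- `δℓ(v) = (x₂ v₁ − x₁ v₂)/r²`. [folklore] -/
theorem spinNullCovector_apply (x v : E4) :
    spinNullCovector x v = (x 2 * v 1 - x 1 * v 2) / radius 0 x ^ 2 := by
  rw [spinNullCovector, E4.covector_apply, Fin.sum_univ_four]
  simp [spinNullCovectorFun]
  ring

/-- **`∂_a ℓ_μ|_{a=0} = δℓ_μ`**, componentwise (`ℓ = (1, (r x₁ + a x₂)/(r² + a²),
(r x₂ − a x₁)/(r² + a²), x₃/r)` with `∂_a r = 0`). [cite: KerrSchild1965, §3] -/
theorem hasDerivAt_nullCovectorFun_spin {x : E4} (hx : 0 < radius 0 x) (μ : Fin 4) :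
    HasDerivAt (fun a : ℝ ↦ nullCovectorFun a x μ) (spinNullCovectorFun x μ) 0 := by
  have hr := hasDerivAt_radius_spin hx
  have hr0 : radius 0 x ≠ 0 := hx.ne'
  have hden : HasDerivAt (fun a : ℝ ↦ radius a x ^ 2 + a ^ 2) 0 0 := by
    have h := (hr.pow 2).add ((hasDerivAt_id' (0 : ℝ)).pow 2)
    exact h.congr_deriv (by simp)
  have hden0 : radius 0 x ^ 2 + (0 : ℝ) ^ 2 ≠ 0 := by positivity
  fin_cases μ
  · simp only [nullCovectorFun, spinNullCovectorFun, Fin.zero_eta, Fin.isValue,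
      Matrix.cons_val_zero]
    exact hasDerivAt_const 0 1
  · have hnum : HasDerivAt (fun a : ℝ ↦ radius a x * x 1 + a * x 2) (x 2) 0 := by
      have h := (hr.mul_const (x 1)).add ((hasDerivAt_id' (0 : ℝ)).mul_const (x 2))
      exact h.congr_deriv (by ring)
    have h := hnum.div hden hden0
    simp only [nullCovectorFun, spinNullCovectorFun, Fin.mk_one, Fin.isValue, Matrix.cons_val_one,
      Matrix.cons_val_zero]
    refine h.congr_deriv ?_
    field_simp
    ring
  · have hnum : HasDerivAt (fun a : ℝ ↦ radius a x * x 2 - a * x 1) (-(x 1)) 0 := by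
      have h := (hr.mul_const (x 2)).sub ((hasDerivAt_id' (0 : ℝ)).mul_const (x 1))
      exact h.congr_deriv (by ring)
    have h := hnum.div hden hden0
    simp only [nullCovectorFun, spinNullCovectorFun, Fin.reduceFinMk, Fin.isValue, Matrix.cons_val]
    refine h.congr_deriv ?_
    field_simp
    ring
  · have h := (hasDerivAt_const (0 : ℝ) (x 3)).div hr hr0
    simp only [nullCovectorFun, spinNullCovectorFun, Fin.reduceFinMk, Fin.isValue, Matrix.cons_val]
    exact h.congr_deriv (by simp)

/-- **`∂_a ℓ|_{a=0} = δℓ`** as a covector-valued derivative. [cite: KerrSchild1965, §3] -/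
theorem hasDerivAt_nullCovector_spin {x : E4} (hx : 0 < radius 0 x) :
    HasDerivAt (fun a : ℝ ↦ nullCovector a x) (spinNullCovector x) 0 := by
  have e : (fun a : ℝ ↦ nullCovector a x) = fun a ↦ ∑ μ, nullCovectorFun a x μ • E4.dx μ := rfl
  rw [e]
  show HasDerivAt (fun a ↦ ∑ μ, nullCovectorFun a x μ • E4.dx μ) (∑ μ, spinNullCovectorFun x μ • E4.dx μ) 0
  exact HasDerivAt.fun_sum fun μ _ ↦ (hasDerivAt_nullCovectorFun_spin hx μ).smul_const (E4.dx μ)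

/-- The null vector in the coordinate basis: `ℓ♯ = −ℓ₀ ∂₀ + ℓ₁ ∂₁ + ℓ₂ ∂₂ + ℓ₃ ∂₃`. [folklore] -/
theorem nullVector_eq_sum (a : ℝ) (x : E4) :
    nullVector a x = (-nullCovectorFun a x 0) • E4.basisVector 0 + nullCovectorFun a x 1 • E4.basisVector 1 +
      nullCovectorFun a x 2 • E4.basisVector 2 + nullCovectorFun a x 3 • E4.basisVector 3 := by
  ext i
  fin_cases i <;> simp [nullVector]

/-- The spin term of the null vector in the coordinate basis. [folklore] -/
theorem spinNullVector_eq_sum (x : E4) :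
    spinNullVector x = spinNullCovectorFun x 1 • E4.basisVector 1 + spinNullCovectorFun x 2 • E4.basisVector 2 := by
  ext i
  fin_cases i <;> simp [spinNullVector, spinNullCovectorFun]

/-- **`∂_a ℓ♯|_{a=0} = δℓ♯`** (vector-valued). [cite: KerrSchild1965, §3] -/
theorem hasDerivAt_nullVector_spin {x : E4} (hx : 0 < radius 0 x) :
    HasDerivAt (fun a : ℝ ↦ nullVector a x) (spinNullVector x) 0 := by
  have e : (fun a : ℝ ↦ nullVector a x) = fun a ↦ (-nullCovectorFun a x 0) • E4.basisVector 0 +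
      nullCovectorFun a x 1 • E4.basisVector 1 + nullCovectorFun a x 2 • E4.basisVector 2 +
      nullCovectorFun a x 3 • E4.basisVector 3 := funext fun a ↦ nullVector_eq_sum a x
  rw [e, spinNullVector_eq_sum]
  have h0 := hasDerivAt_nullCovectorFun_spin hx 0
  have h1 := hasDerivAt_nullCovectorFun_spin hx 1
  have h2 := hasDerivAt_nullCovectorFun_spin hx 2
  have h3 := hasDerivAt_nullCovectorFun_spin hx 3
  have h := (((h0.neg.smul_const (E4.basisVector 0)).add (h1.smul_const (E4.basisVector 1))).add
    (h2.smul_const (E4.basisVector 2))).add (h3.smul_const (E4.basisVector 3))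
  refine h.congr_deriv ?_
  have e0 : spinNullCovectorFun x 0 = 0 := rfl
  have e3 : spinNullCovectorFun x 3 = 0 := rfl
  rw [e0, e3, neg_zero, zero_smul, zero_add, zero_smul, add_zero]

/-! ### The metric: `∂_a g = 2H (ℓ ⊗ δℓ + δℓ ⊗ ℓ)` -/

/-- The first-order spin term of the Kerr–Schild metric,
`∂_a g_{M,a}|_{a=0} = 2H (ℓ ⊗ δℓ + δℓ ⊗ ℓ)` (`H` is even in `a`). [cite: KerrSchild1965, §3] -/
def spinMetric (M : ℝ) (x : E4) : E4 →L[ℝ] E4 →L[ℝ] ℝ :=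
  (2 * scalarH M 0 x) • (E4.tmul (nullCovector 0 x) (spinNullCovector x) +
    E4.tmul (spinNullCovector x) (nullCovector 0 x))

/-- `(∂_a g)(v, w) = 2H (ℓ(v) δℓ(w) + δℓ(v) ℓ(w))`. [folklore] -/
theorem spinMetric_apply (M : ℝ) (x v w : E4) :
    spinMetric M x v w = 2 * scalarH M 0 x *
      (nullCovector 0 x v * spinNullCovector x w + spinNullCovector x v * nullCovector 0 x w) := by
  simp only [spinMetric, FunLike.coe_smul, FunLike.coe_add, Pi.smul_apply, Pi.add_apply, E4.tmul_apply,
    smul_eq_mul]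

/-- **`∂_a g_{M,a}(x)|_{a=0} = 2H (ℓ ⊗ δℓ + δℓ ⊗ ℓ)`** as a form-valued derivative
(`g = η + 2H ℓ ⊗ ℓ`, product rule, `∂_a H = 0`). [cite: KerrSchild1965, §3] -/
theorem hasDerivAt_bilin_spin (M : ℝ) {x : E4} (hx : 0 < radius 0 x) :
    HasDerivAt (fun a : ℝ ↦ bilin M a x) (spinMetric M x) 0 := by
  have hℓ := hasDerivAt_nullCovector_spin hx
  have hH := hasDerivAt_scalarH_spin M hx
  -- `ℓ ⊗ ℓ = ℓ.smulRight ℓ` through the bounded bilinear map `(α, β) ↦ α.smulRight β`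
  have hB := (isBoundedBilinearMap_smulRight (𝕜 := ℝ) (E := E4) (F := E4 →L[ℝ] ℝ)).hasFDerivAt
    (nullCovector 0 x, nullCovector 0 x)
  have hT : HasDerivAt (fun a : ℝ ↦ E4.tmul (nullCovector a x) (nullCovector a x))
      (E4.tmul (nullCovector 0 x) (spinNullCovector x) + E4.tmul (spinNullCovector x) (nullCovector 0 x)) 0 := by
    have h := hB.comp_hasDerivAt 0 (hℓ.prodMk hℓ)
    rw [IsBoundedBilinearMap.deriv_apply] at h
    simp only [E4.tmul]
    exact h
  have h := ((hH.const_mul 2).smul hT).const_add Minkowski.bilin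
  refine h.congr_deriv ?_
  ext v w
  simp only [spinMetric_apply, FunLike.coe_smul, FunLike.coe_add, Pi.smul_apply, Pi.add_apply,
    E4.tmul_apply, smul_eq_mul]
  ring

/-! ### `∇r` and `g♯dr` -/

/-- `Σ̃(−a, y) = Σ̃(a, y)`. [folklore] -/
theorem blSigma_neg (a : ℝ) (y : E3) : blSigma (-a) y = blSigma a y := by
  unfold blSigma
  rw [radius_neg, neg_sq]

/-- `∇r(−a, y) = ∇r(a, y)`. [folklore] -/
theorem radiusGradVec_neg (a : ℝ) (y : E3) : radiusGradVec (-a) y = radiusGradVec a y := by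
  unfold radiusGradVec
  rw [radius_neg, blSigma_neg, neg_sq]

/-- **`∂_a ∇r|_{a=0} = 0`** (even in `a`). [folklore] -/
theorem hasDerivAt_radiusGradVec_spin {y : E3} (hy : 0 < radius 0 (E4.ofTimeSpace 0 y)) :
    HasDerivAt (fun a : ℝ ↦ radiusGradVec a y) 0 0 := by
  refine hasDerivAt_zero_of_even ?_ fun a ↦ radiusGradVec_neg a y
  have hg := (contDiffAt_radiusGradVec₂ (p := ((0 : ℝ), y)) hy (n := 1)).differentiableAt one_ne_zero
  have hf : DifferentiableAt ℝ (fun a : ℝ ↦ ((a, y) : ℝ × E3)) 0 :=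
    differentiableAt_id.prodMk (differentiableAt_const y)
  have h := hg.comp 0 hf
  exact h

/-- **`∂_a (g♯dr)|_{a=0} = −2H δℓ♯`** (`g♯dr = (0, ∇r) − 2H ℓ♯`, `∇r` and `H` even).
[folklore] -/
theorem hasDerivAt_radiusSharp_spin (M : ℝ) {x : E4} (hx : 0 < radius 0 x) :
    HasDerivAt (fun a : ℝ ↦ radiusSharp M a x) (-((2 * scalarH M 0 x) • spinNullVector x)) 0 := by
  have hsp : 0 < radius 0 (E4.ofTimeSpace 0 (E4.spatial x)) := by rwa [radius_ofTimeSpace_spatial]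
  have hg := hasDerivAt_radiusGradVec_spin hsp
  have h1 : HasDerivAt (fun a : ℝ ↦ E4.spaceEmbed (radiusGradVec a (E4.spatial x))) 0 0 := by
    have h := E4.spaceEmbed.hasFDerivAt.comp_hasDerivAt 0 hg
    exact h.congr_deriv (map_zero _)
  have h2 : HasDerivAt (fun a : ℝ ↦ (2 * scalarH M a x) • nullVector a x)
      ((2 * scalarH M 0 x) • spinNullVector x) 0 := by
    have h := ((hasDerivAt_scalarH_spin M hx).const_mul 2).smul (hasDerivAt_nullVector_spin hx)
    exact h.congr_deriv (by simp)
  have h := h1.sub h2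
  have e : (fun a : ℝ ↦ radiusSharp M a x) =
      fun a ↦ E4.spaceEmbed (radiusGradVec a (E4.spatial x)) - (2 * scalarH M a x) • nullVector a x :=
    rfl
  rw [e]
  exact h.congr_deriv (by simp)

/-- `g(g♯dr, g♯dr) = Δ/Σ` is even in the spin near `a = 0`: its spin derivative vanishes.
[folklore] -/
theorem hasDerivAt_bilin_radiusSharp_self_spin (M : ℝ) {x : E4} (hx : 0 < radius 0 x) :
    HasDerivAt (fun a : ℝ ↦ bilin M a x (radiusSharp M a x) (radiusSharp M a x)) 0 0 := by
  have hsp : ∀ a : ℝ, radius a (E4.ofTimeSpace 0 (E4.spatial x)) = radius a x :=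
    fun a ↦ radius_ofTimeSpace_spatial a x
  -- the explicit even formula `(r² − 2Mr + a²)/Σ̃`
  have hr := hasDerivAt_radius_spin hx
  have hS : HasDerivAt (fun a : ℝ ↦ blSigma a (E4.spatial x)) 0 0 := by
    have e : (fun a : ℝ ↦ blSigma a (E4.spatial x)) =
        fun a ↦ 2 * radius a x ^ 2 - ‖E4.spatial x‖ ^ 2 + a ^ 2 := by
      funext a; unfold blSigma; rw [hsp]
    rw [e]
    have h := (((hr.pow 2).const_mul 2).sub_const (‖E4.spatial x‖ ^ 2)).add
      ((hasDerivAt_id' (0 : ℝ)).pow 2)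
    exact h.congr_deriv (by simp)
  have hS0 : blSigma 0 (E4.spatial x) ≠ 0 := (blSigma_spatial_pos hx).ne'
  have hnum : HasDerivAt (fun a : ℝ ↦ radius a x ^ 2 - 2 * M * radius a x + a ^ 2) 0 0 := by
    have h := (((hr.pow 2).sub (hr.const_mul (2 * M)))).add ((hasDerivAt_id' (0 : ℝ)).pow 2)
    exact h.congr_deriv (by simp)
  have hq := hnum.div hS hS0
  have hev : (fun a : ℝ ↦ bilin M a x (radiusSharp M a x) (radiusSharp M a x)) =ᶠ[𝓝 0]
      fun a ↦ (radius a x ^ 2 - 2 * M * radius a x + a ^ 2) / blSigma a (E4.spatial x) := by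
    filter_upwards [eventually_radius_pos hx] with a ha
    exact bilin_radiusSharp_self M ha
  exact (hq.congr_of_eventuallyEq hev).congr_deriv (by simp)

end Kerr

namespace LiMei

/-- **The first-order spin term of the unit normal of the Kerr cylinders**:
`∂_a n_{M,a}(x)|_{a=0} = −c₀ (2H) δℓ♯` with `c₀ = (−g(g♯dr, g♯dr))^{-1/2}` at `a = 0` — the
normalisation is even in `a`, `∂_a(g♯dr) = −2Hδℓ♯` (wherever `r > 0` and
`g(g♯dr, g♯dr) < 0`, i.e. `Δ₀(r) < 0`). [cite: LiMei2020, (4.2)] -/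
theorem hasDerivAt_kerrCylUnitNormal_spin (M : ℝ) {x : E4} (hx : 0 < Kerr.radius 0 x)
    (hq : Kerr.bilin M 0 x (Kerr.radiusSharp M 0 x) (Kerr.radiusSharp M 0 x) < 0) :
    HasDerivAt (fun a : ℝ ↦ kerrCylUnitNormal M a x)
      (-(((Real.sqrt (-Kerr.bilin M 0 x (Kerr.radiusSharp M 0 x) (Kerr.radiusSharp M 0 x)))⁻¹ *
        (2 * Kerr.scalarH M 0 x)) • Kerr.spinNullVector x)) 0 := by
  have hqd := (Kerr.hasDerivAt_bilin_radiusSharp_self_spin M hx).neg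
  have hpos : 0 < -Kerr.bilin M 0 x (Kerr.radiusSharp M 0 x) (Kerr.radiusSharp M 0 x) := by linarith
  have hc : HasDerivAt (fun a : ℝ ↦
      (Real.sqrt (-Kerr.bilin M a x (Kerr.radiusSharp M a x) (Kerr.radiusSharp M a x)))⁻¹) 0 0 := by
    have h := (hqd.sqrt hpos.ne').inv (Real.sqrt_pos.2 hpos).ne'
    exact h.congr_deriv (by simp)
  have hrs := Kerr.hasDerivAt_radiusSharp_spin M hx
  have h := hc.smul hrs
  have e : (fun a : ℝ ↦ kerrCylUnitNormal M a x) = fun a ↦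
      (Real.sqrt (-Kerr.bilin M a x (Kerr.radiusSharp M a x) (Kerr.radiusSharp M a x)))⁻¹ •
        Kerr.radiusSharp M a x := rfl
  rw [e]
  refine h.congr_deriv ?_
  rw [zero_smul, add_zero, smul_neg, smul_smul]

end LiMei

end Literature.Geometry.Lorentzian

end
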